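import Summits.BirchSwinnertonDyer.Rank1Residual.ManinAdditive.SigmaEtaKummer
import HarnessLib

/-!
# Engines for `η`-quotient exponent vectors: level raising, additivity, Jacobi multiplicativity of the Kummer generator (an g35, T-an-38, file E part 1/2)

TYPER NOTE (typer g19, TURNKEY T-an-38, part 1/2 of file E).  SOURCE = HOME/an/g35/SigmaTwoEta-an-g35-v2.lean sha16 a27f55a72dcf1306 (571 l.; an's
check of record SigmaTwoEtaFullSim-an-g35-v2.lean a81dbde9cd3d543c: farm rc 0 · 0 err · 0 warn, axioms standard), lines 23–213 VERBATIM (= an's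
EtaLevelRaising-an-g35.lean 0049b91218938eda, «rc 0 against the tree alone») except this note and five one-line docstrings.  SPLIT for the
400-line cap: part 2 `SigmaTwoEta.lean` = an's lines 214–571 (`RealisesJ`, E-an-158 node, theta realisations, the E-an-154 closers).  CONTENT
(an's words): LEVEL RAISING `M ∣ N` for exponent vectors supported on `M.divisors` (`cuspOrder24 N r c = (N/M)·cuspOrder24 M r (gcd(c,M))`,
`hasEvenCuspOrders_of_dvd`, `newmanCond_of_dvd`; integrality of the ramification index = `gcd(c², ML) ∣ L·gcd(c², M)`), ADDITIVITY
(`hasEvenCuspOrders_add`, `newmanCond_two_mul_add`), JACOBI MULTIPLICATIVITY of the Kummer generator (`jacobiSym_prod_pow_natAbs_add`); plus (moved here from an's part 2, lines 242–290, to keep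
part 2 under the cap) the explicit-`χ` KUMMER BRIDGE `kummerClassEqShimura_of_jacobi`.  Imports `SigmaEtaKummer` only.  Theorem-only; nothing conjectured.  PARTITION 0 · beyond-print theorem: no ·
BSD / C2 / Manin `c = 1` NOT proved by this.
-/

namespace Summit.BirchSwinnertonDyer.Rank1Residual.ManinAdditive.SigmaEta


open Literature.NumberTheory.ModularForms
open Literature.NumberTheory.EllipticCurves.ModularForms
open scoped NumberTheorySymbols

/-! ### gcd bookkeeping -/

/-- `c · gcd(c, N/c) = gcd(c², N)` for `c ∣ N`. -/
theorem mul_gcd_div_eq_gcd_sq {c N : ℕ} (hc : c ∣ N) : c * Nat.gcd c (N / c) = Nat.gcd (c ^ 2) N := by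
  rw [← Nat.gcd_mul_left c c (N / c), Nat.mul_div_cancel' hc, sq]

/-- `gcd(gcd(c,M)², M) = gcd(c², M)`. -/
theorem gcd_gcd_sq (c M : ℕ) : Nat.gcd (Nat.gcd c M ^ 2) M = Nat.gcd (c ^ 2) M := by
  rw [← Nat.pow_gcd_pow, Nat.gcd_assoc, Nat.gcd_eq_right (dvd_pow_self M two_ne_zero)]

/-- `gcd(c², M·L) ∣ L · gcd(c², M)` (integrality of the cusp ramification index under level raising). -/
theorem gcd_sq_mul_dvd (c M L : ℕ) : Nat.gcd (c ^ 2) (M * L) ∣ L * Nat.gcd (c ^ 2) M := by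
  have hg := Nat.gcd_dvd_right (c ^ 2) (M * L)
  obtain ⟨y, z, hy, hz, hyz⟩ := Nat.dvd_mul.mp hg
  have hyc : y ∣ c ^ 2 := (Dvd.intro z hyz).trans (Nat.gcd_dvd_left _ _)
  rw [← hyz, mul_comm y z]
  exact mul_dvd_mul hz (Nat.dvd_gcd hyc hy)

/-- A divisor of a non-zero natural number is non-zero. -/
theorem ne_zero_of_dvd_ne_zero {M N : ℕ} (hMN : M ∣ N) (hN : N ≠ 0) : M ≠ 0 := by
  rintro rfl; exact hN (zero_dvd_iff.mp hMN)

/-! ### Level raising -/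

/-- `cuspOrder24` of a vector supported on the divisors of `M ∣ N`, computed at level `N`. -/
theorem cuspOrder24_of_dvd {M N : ℕ} (hMN : M ∣ N) (hN : N ≠ 0) (r : ℕ → ℤ) (hr : ∀ t ∉ M.divisors, r t = 0)
    (c : ℕ) : cuspOrder24 N r (c : ℤ) = ((N / M : ℕ) : ℤ) * cuspOrder24 M r ((Nat.gcd c M : ℕ) : ℤ) := by
  have hM0 : M ≠ 0 := ne_zero_of_dvd_ne_zero hMN hN
  have hsub := Nat.divisors_subset_of_dvd hN hMN
  unfold cuspOrder24
  rw [← Finset.sum_subset hsub (fun t _ ht => by rw [hr t ht]; simp), Finset.mul_sum]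
  refine Finset.sum_congr rfl fun δ hδ => ?_
  have hδM : δ ∣ M := Nat.dvd_of_mem_divisors hδ
  have h1 : N / δ = N / M * (M / δ) := by
    rw [Nat.div_mul_div_comm hMN hδM, mul_comm N M, Nat.mul_div_mul_left N δ (Nat.pos_of_ne_zero hM0)]
  have h2 : Nat.gcd δ (Nat.gcd c M) = Nat.gcd δ c := by
    rw [← Nat.gcd_assoc, Nat.gcd_eq_left ((Nat.gcd_dvd_left δ c).trans hδM)]
  rw [Int.gcd_natCast_natCast, Int.gcd_natCast_natCast, h2, h1]
  push_cast
  ring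

/-- **Level raising of even cusp orders**: `M ∣ N`, `r` supported on `M.divisors`. -/
theorem hasEvenCuspOrders_of_dvd {M N : ℕ} (hMN : M ∣ N) (hN : N ≠ 0) (r : ℕ → ℤ)
    (hr : ∀ t ∉ M.divisors, r t = 0) (h : HasEvenCuspOrders M r) : HasEvenCuspOrders N r := by
  intro c hc
  have hM0 : M ≠ 0 := ne_zero_of_dvd_ne_zero hMN hN
  have hcN : c ∣ N := Nat.dvd_of_mem_divisors hc
  have hc₀ : Nat.gcd c M ∈ M.divisors := Nat.mem_divisors.mpr ⟨Nat.gcd_dvd_right c M, hM0⟩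
  have h₀ := h (Nat.gcd c M) hc₀
  rw [cuspOrder24_of_dvd hMN hN r hr c]
  have e1 : (c : ℤ) * (Nat.gcd c (N / c) : ℤ) = (Nat.gcd (c ^ 2) N : ℤ) := by
    exact_mod_cast mul_gcd_div_eq_gcd_sq hcN
  have e2 : ((Nat.gcd c M : ℕ) : ℤ) * (Nat.gcd (Nat.gcd c M) (M / Nat.gcd c M) : ℤ) = (Nat.gcd (c ^ 2) M : ℤ) := by
    have := mul_gcd_div_eq_gcd_sq (Nat.gcd_dvd_right c M); rw [gcd_gcd_sq] at this; exact_mod_cast this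
  obtain ⟨L, hL⟩ := hMN
  have hNM : N / M = L := by rw [hL, Nat.mul_div_cancel_left L (Nat.pos_of_ne_zero hM0)]
  have hdvd : (Nat.gcd (c ^ 2) N : ℤ) ∣ (L : ℤ) * (Nat.gcd (c ^ 2) M : ℤ) := by
    rw [hL]; exact_mod_cast gcd_sq_mul_dvd c M L
  rw [mul_assoc, e1, hNM]
  rw [mul_assoc, e2] at h₀
  calc (48 : ℤ) * (Nat.gcd (c ^ 2) N : ℤ) ∣ 48 * ((L : ℤ) * (Nat.gcd (c ^ 2) M : ℤ)) := mul_dvd_mul_left _ hdvd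
    _ = (L : ℤ) * (48 * (Nat.gcd (c ^ 2) M : ℤ)) := by ring
    _ ∣ (L : ℤ) * cuspOrder24 M r ((Nat.gcd c M : ℕ) : ℤ) := mul_dvd_mul_left _ h₀

/-- **Level raising of Newman's conditions** (weight `0`): `M ∣ N`, `r` supported on `M.divisors`. -/
theorem newmanCond_of_dvd {M N : ℕ} (hMN : M ∣ N) (hN : N ≠ 0) (r : ℕ → ℤ)
    (hr : ∀ t ∉ M.divisors, r t = 0) (h : NewmanCond M r 0) : NewmanCond N r 0 := by
  have hM0 : M ≠ 0 := ne_zero_of_dvd_ne_zero hMN hN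
  have hsub := Nat.divisors_subset_of_dvd hN hMN
  refine ⟨?_, ?_, ?_, ?_⟩
  · rw [← Finset.sum_subset hsub (fun t _ ht => hr t ht)]; exact h.sum_eq
  · rw [← Finset.sum_subset hsub (fun t _ ht => by rw [hr t ht, mul_zero])]; exact h.sum_mul_dvd
  · rw [← Finset.sum_subset hsub (fun t _ ht => by rw [hr t ht, mul_zero])]
    have e : ∑ δ ∈ M.divisors, ((N / δ : ℕ) : ℤ) * r δ = ((N / M : ℕ) : ℤ) * ∑ δ ∈ M.divisors, ((M / δ : ℕ) : ℤ) * r δ := by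
      rw [Finset.mul_sum]
      refine Finset.sum_congr rfl fun δ hδ => ?_
      have hδM : δ ∣ M := Nat.dvd_of_mem_divisors hδ
      have h1 : N / δ = N / M * (M / δ) := by
        rw [Nat.div_mul_div_comm hMN hδM, mul_comm N M, Nat.mul_div_mul_left N δ (Nat.pos_of_ne_zero hM0)]
      rw [h1]; push_cast; ring
    rw [e]; exact dvd_mul_of_dvd_right h.sum_div_dvd _
  · rw [← Finset.prod_subset hsub (fun t _ ht => by rw [hr t ht]; simp)]; exact h.isSquare

/-- A vector supported on the divisors of `M` in the form E-an-154 needs it. -/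
theorem support_of_eq_zero {M : ℕ} {r : ℕ → ℤ} (hr : ∀ t ∉ M.divisors, r t = 0) (k : ℤ) :
    ∀ t ∉ M.divisors, (fun t => k * r t) t = 0 := fun t ht => by simp [hr t ht]

/-! ### Additivity -/

/-- `cuspOrder24` is additive in the exponent vector. -/
theorem cuspOrder24_add (N : ℕ) (r₁ r₂ : ℕ → ℤ) (c : ℤ) :
    cuspOrder24 N (fun t => r₁ t + r₂ t) c = cuspOrder24 N r₁ c + cuspOrder24 N r₂ c := by
  unfold cuspOrder24
  rw [← Finset.sum_add_distrib]
  exact Finset.sum_congr rfl fun δ _ => by ring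

/-- `HasEvenCuspOrders` is additive in the exponent vector. -/
theorem hasEvenCuspOrders_add {N : ℕ} {r₁ r₂ : ℕ → ℤ} (h₁ : HasEvenCuspOrders N r₁) (h₂ : HasEvenCuspOrders N r₂) :
    HasEvenCuspOrders N (fun t => r₁ t + r₂ t) := by
  intro c hc
  rw [cuspOrder24_add]
  exact dvd_add (h₁ c hc) (h₂ c hc)

/-- `∏ δ^{|2 r_δ|}` is a square. -/
theorem isSquare_prod_pow_natAbs_two_mul (s : Finset ℕ) (r : ℕ → ℤ) :
    IsSquare (∏ δ ∈ s, δ ^ (2 * r δ).natAbs) := by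
  refine ⟨∏ δ ∈ s, δ ^ (r δ).natAbs, ?_⟩
  rw [← Finset.prod_mul_distrib]
  refine Finset.prod_congr rfl fun δ _ => ?_
  rw [Int.natAbs_mul, show (2 : ℤ).natAbs = 2 from rfl, two_mul, pow_add]

/-- Weight-`0` Newman conditions are additive for doubled exponent vectors. -/
theorem newmanCond_two_mul_add {N : ℕ} {r₁ r₂ : ℕ → ℤ} (h₁ : NewmanCond N (fun t => 2 * r₁ t) 0)
    (h₂ : NewmanCond N (fun t => 2 * r₂ t) 0) : NewmanCond N (fun t => 2 * (r₁ t + r₂ t)) 0 := by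
  refine ⟨?_, ?_, ?_, ?_⟩
  · have e₁ := h₁.sum_eq; have e₂ := h₂.sum_eq
    simp only [mul_add, Finset.sum_add_distrib] at e₁ e₂ ⊢
    linear_combination e₁ + e₂
  · have e₁ := h₁.sum_mul_dvd; have e₂ := h₂.sum_mul_dvd
    simp only [mul_add, Finset.sum_add_distrib]
    exact dvd_add e₁ e₂
  · have e₁ := h₁.sum_div_dvd; have e₂ := h₂.sum_div_dvd
    simp only [mul_add, Finset.sum_add_distrib]
    exact dvd_add e₁ e₂
  · exact isSquare_prod_pow_natAbs_two_mul _ _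

/-- Negation keeps weight-`0` Newman conditions for doubled vectors and even cusp orders (inverse `η`-quotient). -/
theorem newmanCond_two_mul_neg {N : ℕ} {r : ℕ → ℤ} (h : NewmanCond N (fun t => 2 * r t) 0) :
    NewmanCond N (fun t => 2 * (-r t)) 0 := by
  refine ⟨?_, ?_, ?_, ?_⟩
  · have e := h.sum_eq
    simp only [mul_neg, Finset.sum_neg_distrib] at e ⊢
    linear_combination -e
  · have e := h.sum_mul_dvd
    simp only [mul_neg, Finset.sum_neg_distrib]
    exact (dvd_neg).mpr e
  · have e := h.sum_div_dvd
    simp only [mul_neg, Finset.sum_neg_distrib]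
    exact (dvd_neg).mpr e
  · exact isSquare_prod_pow_natAbs_two_mul _ _

/-- Even cusp orders are preserved by negating the exponent vector. -/
theorem hasEvenCuspOrders_neg {N : ℕ} {r : ℕ → ℤ} (h : HasEvenCuspOrders N r) : HasEvenCuspOrders N (fun t => -r t) := by
  intro c hc
  have e : cuspOrder24 N (fun t => -r t) c = -cuspOrder24 N r c := by
    unfold cuspOrder24; rw [← Finset.sum_neg_distrib]; exact Finset.sum_congr rfl fun δ _ => by ring
  rw [e]; exact (dvd_neg).mpr (h c hc)

/-! ### Jacobi multiplicativity of the Kummer generator `s' = ∏ t^{|r_t|}` -/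

/-- The Jacobi symbol of a product of powers is the product of the powers of the Jacobi symbols. -/
theorem jacobiSym_natCast_prod_pow (D : Finset ℕ) (e : ℕ → ℕ) (d : ℕ) :
    J(((∏ t ∈ D, t ^ e t : ℕ) : ℤ) | d) = ∏ t ∈ D, J((t : ℤ) | d) ^ e t := by
  classical
  induction D using Finset.induction_on with
  | empty => simp [jacobiSym.one_left]
  | insert a s ha ih =>
    rw [Finset.prod_insert ha, Finset.prod_insert ha, Nat.cast_mul, jacobiSym.mul_left, ih, Nat.cast_pow,
      jacobiSym.pow_left]

/-- `(-1)^{|a+b|} = (-1)^{|a|} · (-1)^{|b|}` for integers `a, b`. -/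
theorem neg_one_pow_natAbs_add (a b : ℤ) : (-1 : ℤ) ^ (a + b).natAbs = (-1) ^ a.natAbs * (-1) ^ b.natAbs := by
  rcases Int.even_or_odd a with ha | ha <;> rcases Int.even_or_odd b with hb | hb
  · rw [(Int.natAbs_even.mpr (ha.add hb)).neg_one_pow, (Int.natAbs_even.mpr ha).neg_one_pow,
      (Int.natAbs_even.mpr hb).neg_one_pow, one_mul]
  · rw [(Int.natAbs_odd.mpr (ha.add_odd hb)).neg_one_pow, (Int.natAbs_even.mpr ha).neg_one_pow,
      (Int.natAbs_odd.mpr hb).neg_one_pow, one_mul]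
  · rw [(Int.natAbs_odd.mpr (ha.add_even hb)).neg_one_pow, (Int.natAbs_odd.mpr ha).neg_one_pow,
      (Int.natAbs_even.mpr hb).neg_one_pow, mul_one]
  · rw [(Int.natAbs_even.mpr (ha.add_odd hb)).neg_one_pow, (Int.natAbs_odd.mpr ha).neg_one_pow,
      (Int.natAbs_odd.mpr hb).neg_one_pow]; norm_num

/-- **Jacobi multiplicativity**: for `d` coprime to every `t ∈ D`,
`J(∏ t^{|a_t + b_t|} | d) = J(∏ t^{|a_t|} | d) · J(∏ t^{|b_t|} | d)`. -/
theorem jacobiSym_prod_pow_natAbs_add {D : Finset ℕ} {d : ℕ} (hd : ∀ t ∈ D, Int.gcd (t : ℤ) d = 1)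
    (a b : ℕ → ℤ) :
    J(((∏ t ∈ D, t ^ (a t + b t).natAbs : ℕ) : ℤ) | d) =
      J(((∏ t ∈ D, t ^ (a t).natAbs : ℕ) : ℤ) | d) * J(((∏ t ∈ D, t ^ (b t).natAbs : ℕ) : ℤ) | d) := by
  rw [jacobiSym_natCast_prod_pow, jacobiSym_natCast_prod_pow, jacobiSym_natCast_prod_pow, ← Finset.prod_mul_distrib]
  refine Finset.prod_congr rfl fun t ht => ?_
  rcases jacobiSym.eq_one_or_neg_one (hd t ht) with h | h
  · rw [h]; simp
  · rw [h]; exact neg_one_pow_natAbs_add (a t) (b t)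

/-- The same for the negated vector: `J(∏ t^{|−a_t|} | d) = J(∏ t^{|a_t|} | d)`. -/
theorem prod_pow_natAbs_neg (D : Finset ℕ) (a : ℕ → ℤ) :
    (∏ t ∈ D, t ^ (-a t).natAbs) = ∏ t ∈ D, t ^ (a t).natAbs := by
  simp only [Int.natAbs_neg]

/-! ### The explicit-`χ` Kummer bridge (tree proofs of `shimuraTwoCharOfJacobiProductAtFour_of_kronecker` and
`etaSquareKummerIsSigmaAtFour_of_jacobiProduct`, with the character given rather than produced) -/

/-- The explicit-`χ` Kummer bridge: Newman + even cusp orders for `2r` and `χ(d) = (s' | |d|)` on odd `d` coprime to `N` give `KummerClassEqShimura N (2r) χ`. -/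
theorem kummerClassEqShimura_of_jacobi {N : ℕ} (hN : 4 ∣ N) (r : ℕ → ℤ) (χ : DirichletCharacter ℤ N)
    (hnc : NewmanCond N (fun t => 2 * r t) 0) (hev : HasEvenCuspOrders N (fun t => 2 * r t))
    (hkron : ∀ d : ℤ, Odd d → IsCoprime d N →
      J(((∏ t ∈ N.divisors, t ^ (r t).natAbs : ℕ) : ℤ) | d.natAbs) = χ (d : ZMod N)) :
    KummerClassEqShimura N (fun t => 2 * r t) χ := by
  intro a b c d hdet hc hNc
  have hsum0 : ∑ t ∈ N.divisors, r t = 0 := by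
    have h := hnc.sum_eq
    simp only [mul_zero] at h
    rw [← Finset.mul_sum] at h
    linarith [h]
  obtain ⟨h24a, h24b⟩ := mod24_of_hasEvenCuspOrders N r hev
  have hceven : Even c := by
    obtain ⟨k, hk⟩ := hNc
    obtain ⟨m, hm⟩ := hN
    exact ⟨k * 2 * m, by rw [hk, hm]; push_cast; ring⟩
  have hd : Odd d := by
    by_contra h
    rw [Int.not_odd_iff_even] at h
    have : Even (a * d - b * c) := Int.even_sub.mpr ⟨fun _ => hceven.mul_left b, fun _ => h.mul_left a⟩
    rw [hdet] at this
    exact Int.not_even_one this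
  obtain ⟨n, e, hs, he⟩ := sum_rademacherPhi_conj_eq_of_odd N r hsum0 h24a h24b hdet hc hNc hd
  refine ⟨2 * n + e, ?_, ?_⟩
  · have : ∑ t ∈ N.divisors, (((fun t => 2 * r t) t : ℤ) : ℚ) * rademacherPhi a (t * b) (c / t) d
        = 2 * ∑ t ∈ N.divisors, (r t : ℚ) * rademacherPhi a (t * b) (c / t) d := by
      rw [Finset.mul_sum]
      refine Finset.sum_congr rfl fun t _ => ?_
      push_cast; ring
    rw [this, hs]; push_cast; ring
  · have hcd : IsCoprime c d := ⟨-b, a, by linear_combination hdet⟩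
    have hdN : IsCoprime d (N : ℤ) := by
      obtain ⟨k, hk⟩ := hNc
      have : IsCoprime d c := hcd.symm
      rw [hk] at this
      exact this.of_mul_right_left
    rw [prod_jacobiSym_conj_zpow_eq N r hsum0 hNc hcd hd, hkron d hd hdN] at he
    have h2n : Even (2 * n + e) ↔ Even e := by
      constructor
      · intro h; simpa using (Int.even_add.mp h).mp (even_two_mul n)
      · intro h; exact Int.even_add.mpr ⟨fun _ => h, fun _ => even_two_mul n⟩
    rw [h2n, ← cexp_pi_I_mul_int_eq_one_iff' e, he]
    rcases dirichletChar_int_sq_eq_one χ hdN with h1 | h1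
    · simp [h1]
    · rw [h1]; norm_num

end Summit.BirchSwinnertonDyer.Rank1Residual.ManinAdditive.SigmaEta
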